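import Summits.Ventures.PercRepro2.CaseOneStarMain
import Summits.Ventures.PercRepro2.CaseOneStarMassYU
import Summits.Ventures.PercRepro2.CaseOneStarAggQt

/-!
# The marked star: `(ii-Q)` for every `a₃` adjacent exactly to `a₁, a₂, o, b`
(blind cell PercRepro2, p1 g16; S5 §2.1 (K9) (q): the `a1(u)` row of the pendant lemma (j))

`iiExprT_eq_iiQt4`: the Q-threshold form `iiExprT (Dqo) (P(Q))` is the polynomial `iiQt4` at the edge
weights and the cell masses of the pinned law (the seven masses, `mass_YU` for `Y_U = P(Q, o ∈ U)`), and
`iiQt4_nonneg` (CaseOneStarAggQt.lean) gives **`zSplitIIQ_of_markedStar`**: `(ii-Q)` for every finite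
graph, every weight vector, every `a₃` whose edges are exactly the four edges to `a₁, a₂, o, b`. With
`zSplitII_of_markedStar` and K8 (`zSplitII_of_leaf_at`) this closes `(ii)` for every pendant vertex at such
an `a₃` (CaseOneStarPendant.lean). -/

namespace Summit.Ventures.PercRepro2

namespace CaseOne

section ClosedQt
variable {V : Type*} {E : Type*} [Fintype E] [DecidableEq E] [Fintype V] [DecidableEq V]
  {R : Type*} [Field R] [LinearOrder R] [IsStrictOrderedRing R]
variable {ends : E → Sym2 V} {o a₁ a₂ b a₃ : V} {e₁ e₂ eo eb : E}

omit [Fintype V] [DecidableEq V] [LinearOrder R] [IsStrictOrderedRing R] in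
/-- The mass polynomial `smYU` at the cell masses is the mixture of `mass_YU`. -/
lemma smYU_mix (p : E → R) (e₁ e₂ eo eb : E) :
    smYU (p e₁) (p e₂) (p eo) (p eb) (scells (pin4 p e₁ e₂ eo eb) ends o a₁ a₂ b) =
      p e₁ * p e₂ * p eo * p eb * 0 +
      p e₁ * p e₂ * p eo * (1 - p eb) * 0 +
      p e₁ * p e₂ * (1 - p eo) * p eb * 0 +
      p e₁ * p e₂ * (1 - p eo) * (1 - p eb) * 0 +
      p e₁ * (1 - p e₂) * p eo * p eb * (cellMass (pin4 p e₁ e₂ eo eb) ends o a₁ a₂ b 1 + cellMass (pin4 p e₁ e₂ eo eb) ends o a₁ a₂ b 3 + cellMass (pin4 p e₁ e₂ eo eb) ends o a₁ a₂ b 4 + cellMass (pin4 p e₁ e₂ eo eb) ends o a₁ a₂ b 9 + cellMass (pin4 p e₁ e₂ eo eb) ends o a₁ a₂ b 10) +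
      p e₁ * (1 - p e₂) * p eo * (1 - p eb) * (cellMass (pin4 p e₁ e₂ eo eb) ends o a₁ a₂ b 1 + cellMass (pin4 p e₁ e₂ eo eb) ends o a₁ a₂ b 2 + cellMass (pin4 p e₁ e₂ eo eb) ends o a₁ a₂ b 3 + cellMass (pin4 p e₁ e₂ eo eb) ends o a₁ a₂ b 4 + cellMass (pin4 p e₁ e₂ eo eb) ends o a₁ a₂ b 5 + cellMass (pin4 p e₁ e₂ eo eb) ends o a₁ a₂ b 9 + cellMass (pin4 p e₁ e₂ eo eb) ends o a₁ a₂ b 10) +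
      p e₁ * (1 - p e₂) * (1 - p eo) * p eb * (cellMass (pin4 p e₁ e₂ eo eb) ends o a₁ a₂ b 3 + cellMass (pin4 p e₁ e₂ eo eb) ends o a₁ a₂ b 4 + cellMass (pin4 p e₁ e₂ eo eb) ends o a₁ a₂ b 6 + cellMass (pin4 p e₁ e₂ eo eb) ends o a₁ a₂ b 7 + cellMass (pin4 p e₁ e₂ eo eb) ends o a₁ a₂ b 10) +
      p e₁ * (1 - p e₂) * (1 - p eo) * (1 - p eb) * (cellMass (pin4 p e₁ e₂ eo eb) ends o a₁ a₂ b 3 + cellMass (pin4 p e₁ e₂ eo eb) ends o a₁ a₂ b 4 + cellMass (pin4 p e₁ e₂ eo eb) ends o a₁ a₂ b 5 + cellMass (pin4 p e₁ e₂ eo eb) ends o a₁ a₂ b 6 + cellMass (pin4 p e₁ e₂ eo eb) ends o a₁ a₂ b 7 + cellMass (pin4 p e₁ e₂ eo eb) ends o a₁ a₂ b 8) +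
      (1 - p e₁) * p e₂ * p eo * p eb * (cellMass (pin4 p e₁ e₂ eo eb) ends o a₁ a₂ b 2 + cellMass (pin4 p e₁ e₂ eo eb) ends o a₁ a₂ b 6 + cellMass (pin4 p e₁ e₂ eo eb) ends o a₁ a₂ b 8 + cellMass (pin4 p e₁ e₂ eo eb) ends o a₁ a₂ b 9 + cellMass (pin4 p e₁ e₂ eo eb) ends o a₁ a₂ b 10) +
      (1 - p e₁) * p e₂ * p eo * (1 - p eb) * (cellMass (pin4 p e₁ e₂ eo eb) ends o a₁ a₂ b 1 + cellMass (pin4 p e₁ e₂ eo eb) ends o a₁ a₂ b 2 + cellMass (pin4 p e₁ e₂ eo eb) ends o a₁ a₂ b 6 + cellMass (pin4 p e₁ e₂ eo eb) ends o a₁ a₂ b 7 + cellMass (pin4 p e₁ e₂ eo eb) ends o a₁ a₂ b 8 + cellMass (pin4 p e₁ e₂ eo eb) ends o a₁ a₂ b 9 + cellMass (pin4 p e₁ e₂ eo eb) ends o a₁ a₂ b 10) +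
      (1 - p e₁) * p e₂ * (1 - p eo) * p eb * (cellMass (pin4 p e₁ e₂ eo eb) ends o a₁ a₂ b 3 + cellMass (pin4 p e₁ e₂ eo eb) ends o a₁ a₂ b 5 + cellMass (pin4 p e₁ e₂ eo eb) ends o a₁ a₂ b 6 + cellMass (pin4 p e₁ e₂ eo eb) ends o a₁ a₂ b 8 + cellMass (pin4 p e₁ e₂ eo eb) ends o a₁ a₂ b 10) +
      (1 - p e₁) * p e₂ * (1 - p eo) * (1 - p eb) * (cellMass (pin4 p e₁ e₂ eo eb) ends o a₁ a₂ b 3 + cellMass (pin4 p e₁ e₂ eo eb) ends o a₁ a₂ b 4 + cellMass (pin4 p e₁ e₂ eo eb) ends o a₁ a₂ b 5 + cellMass (pin4 p e₁ e₂ eo eb) ends o a₁ a₂ b 6 + cellMass (pin4 p e₁ e₂ eo eb) ends o a₁ a₂ b 7 + cellMass (pin4 p e₁ e₂ eo eb) ends o a₁ a₂ b 8) +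
      (1 - p e₁) * (1 - p e₂) * p eo * p eb * (cellMass (pin4 p e₁ e₂ eo eb) ends o a₁ a₂ b 1 + cellMass (pin4 p e₁ e₂ eo eb) ends o a₁ a₂ b 2 + cellMass (pin4 p e₁ e₂ eo eb) ends o a₁ a₂ b 3 + cellMass (pin4 p e₁ e₂ eo eb) ends o a₁ a₂ b 4 + cellMass (pin4 p e₁ e₂ eo eb) ends o a₁ a₂ b 6 + cellMass (pin4 p e₁ e₂ eo eb) ends o a₁ a₂ b 8) +
      (1 - p e₁) * (1 - p e₂) * p eo * (1 - p eb) * (cellMass (pin4 p e₁ e₂ eo eb) ends o a₁ a₂ b 3 + cellMass (pin4 p e₁ e₂ eo eb) ends o a₁ a₂ b 4 + cellMass (pin4 p e₁ e₂ eo eb) ends o a₁ a₂ b 5 + cellMass (pin4 p e₁ e₂ eo eb) ends o a₁ a₂ b 6 + cellMass (pin4 p e₁ e₂ eo eb) ends o a₁ a₂ b 7 + cellMass (pin4 p e₁ e₂ eo eb) ends o a₁ a₂ b 8) +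
      (1 - p e₁) * (1 - p e₂) * (1 - p eo) * p eb * (cellMass (pin4 p e₁ e₂ eo eb) ends o a₁ a₂ b 3 + cellMass (pin4 p e₁ e₂ eo eb) ends o a₁ a₂ b 4 + cellMass (pin4 p e₁ e₂ eo eb) ends o a₁ a₂ b 5 + cellMass (pin4 p e₁ e₂ eo eb) ends o a₁ a₂ b 6 + cellMass (pin4 p e₁ e₂ eo eb) ends o a₁ a₂ b 7 + cellMass (pin4 p e₁ e₂ eo eb) ends o a₁ a₂ b 8) +
      (1 - p e₁) * (1 - p e₂) * (1 - p eo) * (1 - p eb) * (cellMass (pin4 p e₁ e₂ eo eb) ends o a₁ a₂ b 3 + cellMass (pin4 p e₁ e₂ eo eb) ends o a₁ a₂ b 4 + cellMass (pin4 p e₁ e₂ eo eb) ends o a₁ a₂ b 5 + cellMass (pin4 p e₁ e₂ eo eb) ends o a₁ a₂ b 6 + cellMass (pin4 p e₁ e₂ eo eb) ends o a₁ a₂ b 7 + cellMass (pin4 p e₁ e₂ eo eb) ends o a₁ a₂ b 8) := by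
  unfold smYU scells
  ring

omit [Fintype V] [DecidableEq V] [LinearOrder R] [IsStrictOrderedRing R] in
/-- **The Q-threshold form is `iiQt4`** at the four edge weights and the cell masses of the pinned law. -/
theorem iiExprT_eq_iiQt4 (p : E → R) (h : IsMarkedStarAt ends o a₁ a₂ b a₃ e₁ e₂ eo eb) :
    iiExprT p ends o a₁ a₂ a₃ b (Dqo p ends o a₁ a₂) (prob p (connEvent ends a₁ a₂)ᶜ) =
      iiQt4 (p e₁) (p e₂) (p eo) (p eb) (scells (pin4 p e₁ e₂ eo eb) ends o a₁ a₂ b) := by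
  rw [iiExprT_eq, mass_Q p h, mass_QB p h, mass_QA p h, mass_QAO p h, mass_QAB p h, mass_QABO p h,
    mass_YU p h, ← smQ_mix p e₁ e₂ eo eb, ← smQB_mix p e₁ e₂ eo eb, ← smQA_mix p e₁ e₂ eo eb,
    ← smQAO_mix p e₁ e₂ eo eb, ← smQAB_mix p e₁ e₂ eo eb, ← smQABO_mix p e₁ e₂ eo eb,
    ← smYU_mix p e₁ e₂ eo eb]
  rfl

/-- **`(ii-Q)` for every `a₃` adjacent exactly to `a₁`, `a₂`, `o` and `b`, every finite graph, every
weight vector** — the small-weight pendant inequality `a1(a₃) ≥ 0` of the pendant lemma. -/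
theorem zSplitIIQ_of_markedStar (p : E → R) (hp : IsProbVec p)
    (h : IsMarkedStarAt ends o a₁ a₂ b a₃ e₁ e₂ eo eb) : ZSplitIIQ p ends o a₁ a₂ a₃ b := by
  unfold ZSplitIIQ
  rw [iiExprT_eq_iiQt4 p h]
  have hp0 : IsProbVec (pin4 p e₁ e₂ eo eb) :=
    (((hp.update e₁ le_rfl zero_le_one).update e₂ le_rfl zero_le_one).update eo le_rfl zero_le_one).update
      eb le_rfl zero_le_one
  exact iiQt4_nonneg _ _ _ _ _ (sFacts (pin4 p e₁ e₂ eo eb) hp0) (hp.nonneg e₁) (hp.le_one e₁)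
    (hp.nonneg e₂) (hp.le_one e₂) (hp.nonneg eo) (hp.le_one eo) (hp.nonneg eb) (hp.le_one eb)

end ClosedQt

end CaseOne

end Summit.Ventures.PercRepro2
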